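import Mathlib
import Summits.ValiantsHypothesis.ValiantsHypothesis.Theorems.NewtonUnitEquationsNewtonTauWeakCornerDefs
import Summits.ValiantsHypothesis.ValiantsHypothesis.Theorems.NewtonUnitEquationsNewtonTauWeakK3Defs

/-!
# `NewtonTauWeak` (stmt-ValiantsHypothesis-5904), stub `fixedKCoincidence_t2_K3`: the tops of a sum of three
# binomial products at a generic weight, under "no short 2-vs-1 relations"

Helper file of the proof of the `K = 3` sub-stub `fixedKCoincidence_t2_K3` of `stub_binomialNewtonTauCommon`
(line `binomial-normal-form`; siege variation "polynomial identity route").  For the stub's polynomial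
`f = Σ_{l<3} c_l Π_j (1 - ρ_{lj} X^{d_j})`, a line structure `(q, cl, g)` of the exponent list
(`…K3PiFlip.lean`) and a set `SL` of flipped lines, this file supplies the two facts about the local directions
`E_e = ∓ q_e` needed by the local analysis at a generic weight (positivity for the opposite weight,
`wt_neg_flipDir_pos`; pairwise non-parallel rays, `flipDir_nonparallel`) and shows that the stub's hypothesis (no
short 2-vs-1 relations among the directions, within multiplicity range) EXCLUDES the escape clause of the local
lemmas: `k₁ E_{e₁} + k₂ E_{e₂}` is on no ray when `k_i` is at most the multiplicity of the line `e_i`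
(`not_onRay_of_noShort`).  No definitions. [this line; new]
-/

set_option linter.dupNamespace false

noncomputable section

open scoped BigOperators Polynomial

namespace Summit.ValiantsHypothesis.ValiantsHypothesis.Theorems.NewtonUnitEquationsNewtonTauWeak

open Summit.ValiantsHypothesis.ValiantsHypothesis.Theorems.NewtonTauWeakCorner
open Summit.ValiantsHypothesis.ValiantsHypothesis.Theorems.NewtonTauWeakK3
open Summit.ValiantsHypothesis.ValiantsHypothesis.Theorems.NewtonTauWeakVdp (wdeg IsGeneric IsTop)

namespace K3Pi

/-! ## The local directions of a line structure at a generic weight -/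

/-- Parallel multiples of two lattice directions force the directions to be parallel. [folklore] -/
theorem det_eq_zero_of_smul_eq (q₁ q₂ : Fin 2 →₀ ℕ) (s₁ s₂ : ℤ) (k k' : ℤ) (hk : k ≠ 0) (hs : s₁ ≠ 0)
    (h : k • (s₁ • expZ q₁) = k' • (s₂ • expZ q₂)) : (q₁ 0 : ℤ) * q₂ 1 = (q₁ 1 : ℤ) * q₂ 0 := by
  have h0 := congr_fun h 0
  have h1 := congr_fun h 1
  simp only [Pi.smul_apply, smul_eq_mul, expZ_apply] at h0 h1
  have : k * s₁ * ((q₁ 0 : ℤ) * q₂ 1 - (q₁ 1 : ℤ) * q₂ 0) = 0 := by linear_combination (q₂ 1 : ℤ) * h0 - (q₂ 0 : ℤ) * h1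
  rcases mul_eq_zero.mp this with h' | h'
  · exact absurd h' (mul_ne_zero hk hs)
  · linarith

/-- The flipped/unflipped primitive directions weigh positively for the opposite weight. [folklore] -/
theorem wt_neg_flipDir_pos {s : ℕ} (q : Fin s → Fin 2 →₀ ℕ) (hq0 : ∀ e, q e ≠ 0) (w : Fin 2 → ℝ)
    (hw : IsGeneric w) (SL : Finset (Fin s)) (hSL : ∀ e, e ∈ SL ↔ 0 < wdeg w (q e)) (e : Fin s) :
    0 < wt (-w) (if e ∈ SL then -expZ (q e) else expZ (q e)) := by
  by_cases he : e ∈ SL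
  · rw [if_pos he, wt_neg, wt_neg_left, neg_neg, wt_expZ]; exact (hSL e).mp he
  · rw [if_neg he, wt_neg_left, wt_expZ]
    have hle : wdeg w (q e) ≤ 0 := not_lt.mp fun h => he ((hSL e).mpr h)
    have hne : wdeg w (q e) ≠ 0 := by
      intro h0
      apply hq0 e
      apply hw
      rw [h0, NewtonTauWeakVdp.wdeg_zero]
    have := lt_of_le_of_ne hle hne
    linarith

/-- The flipped/unflipped primitive directions of distinct lines span non-parallel rays. [folklore] -/
theorem flipDir_nonparallel {s : ℕ} (q : Fin s → Fin 2 →₀ ℕ)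
    (hqq : ∀ e e', e ≠ e' → (q e) 0 * (q e') 1 ≠ (q e) 1 * (q e') 0) (SL : Finset (Fin s)) :
    ∀ e e' : Fin s, ∀ k k' : ℕ, 1 ≤ k →
      (k : ℤ) • (if e ∈ SL then -expZ (q e) else expZ (q e)) =
        (k' : ℤ) • (if e' ∈ SL then -expZ (q e') else expZ (q e')) → e = e' := by
  intro e e' k k' hk h
  by_contra hne
  apply hqq e e' hne
  have hs : ∀ x : Fin s, (if x ∈ SL then -expZ (q x) else expZ (q x)) =
      (if x ∈ SL then (-1 : ℤ) else 1) • expZ (q x) := by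
    intro x; split_ifs <;> simp
  rw [hs e, hs e'] at h
  have hk0 : (k : ℤ) ≠ 0 := by exact_mod_cast (show k ≠ 0 by omega)
  have hs0 : (if e ∈ SL then (-1 : ℤ) else 1) ≠ 0 := by split_ifs <;> norm_num
  have := det_eq_zero_of_smul_eq (q e) (q e') _ _ (k : ℤ) (k' : ℤ) hk0 hs0 h
  exact_mod_cast this

/-! ## The hypothesis "no short 2-vs-1 relations" kills the escape clause -/

/-- **No escape.** Under the stub's hypothesis on `d`, for two distinct lines `e₁ ≠ e₂` and multiplicities
`1 ≤ k_i ≤ Σ_{j on e_i} g_j`, the point `k₁ E_{e₁} + k₂ E_{e₂}` lies on no ray of the line structure. [this line] -/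
theorem not_onRay_of_noShort {N s : ℕ} (d : Fin N → Fin 2 →₀ ℕ) (q : Fin s → Fin 2 →₀ ℕ)
    (cl : Fin N → Fin s) (g : Fin N → ℕ) (hq0 : ∀ e, q e ≠ 0) (hsurj : ∀ e, ∃ j, d j ≠ 0 ∧ cl j = e)
    (hcl : ∀ j, d j ≠ 0 → 1 ≤ g j ∧ d j = g j • q (cl j))
    (hqq : ∀ e e', e ≠ e' → (q e) 0 * (q e') 1 ≠ (q e) 1 * (q e') 0)
    (H : ∀ (j₁ j₂ j₃ : Fin N) (z₁ z₂ : Fin 2 → ℤ), d j₁ ≠ 0 → d j₂ ≠ 0 → d j₃ ≠ 0 →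
      (d j₁ 0 : ℤ) * (d j₂ 1 : ℤ) ≠ (d j₁ 1 : ℤ) * (d j₂ 0 : ℤ) → z₁ ≠ 0 → z₁ 0 * (d j₁ 1 : ℤ) = z₁ 1 * (d j₁ 0 : ℤ) →
      (∀ i, |z₁ i| ≤ ∑ j, if (d j 0 : ℤ) * (d j₁ 1 : ℤ) = (d j 1 : ℤ) * (d j₁ 0 : ℤ) then (d j i : ℤ) else 0) →
      z₂ ≠ 0 → z₂ 0 * (d j₂ 1 : ℤ) = z₂ 1 * (d j₂ 0 : ℤ) →
      (∀ i, |z₂ i| ≤ ∑ j, if (d j 0 : ℤ) * (d j₂ 1 : ℤ) = (d j 1 : ℤ) * (d j₂ 0 : ℤ) then (d j i : ℤ) else 0) →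
      (z₁ 0 + z₂ 0) * (d j₃ 1 : ℤ) ≠ (z₁ 1 + z₂ 1) * (d j₃ 0 : ℤ))
    (SL : Finset (Fin s)) (e₁ e₂ : Fin s) (hne : e₁ ≠ e₂) (k₁ k₂ : ℕ) (hk₁ : 1 ≤ k₁) (hk₂ : 1 ≤ k₂)
    (hk₁m : k₁ ≤ ∑ j ∈ Finset.univ.filter (fun j => d j ≠ 0 ∧ cl j = e₁), g j)
    (hk₂m : k₂ ≤ ∑ j ∈ Finset.univ.filter (fun j => d j ≠ 0 ∧ cl j = e₂), g j) :
    ¬ OnRay (fun e => if e ∈ SL then -expZ (q e) else expZ (q e))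
      ((k₁ : ℤ) • (if e₁ ∈ SL then -expZ (q e₁) else expZ (q e₁)) +
        (k₂ : ℤ) • (if e₂ ∈ SL then -expZ (q e₂) else expZ (q e₂))) := by
  classical
  rintro ⟨e₀, k, hk, hray⟩
  -- signs of the three local directions
  have hs : ∀ x : Fin s, (if x ∈ SL then -expZ (q x) else expZ (q x)) =
      (if x ∈ SL then (-1 : ℤ) else 1) • expZ (q x) := by
    intro x; split_ifs <;> simp
  simp only [hs] at hray
  set σ : Fin s → ℤ := fun x => if x ∈ SL then (-1 : ℤ) else 1 with hσ
  have hσabs : ∀ x, |σ x| = 1 := by intro x; simp only [hσ]; split_ifs <;> simp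
  have hσne : ∀ x, σ x ≠ 0 := by intro x; simp only [hσ]; split_ifs <;> norm_num
  have hray' : (k₁ : ℤ) • (σ e₁ • expZ (q e₁)) + (k₂ : ℤ) • (σ e₂ • expZ (q e₂)) = (k : ℤ) • (σ e₀ • expZ (q e₀)) :=
    hray
  -- members of the three lines
  obtain ⟨j₁, hd₁, hc₁⟩ := hsurj e₁
  obtain ⟨j₂, hd₂, hc₂⟩ := hsurj e₂
  obtain ⟨j₃, hd₃, hc₃⟩ := hsurj e₀
  obtain ⟨hg₁, hdq₁⟩ := hcl j₁ hd₁
  obtain ⟨hg₂, hdq₂⟩ := hcl j₂ hd₂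
  obtain ⟨-, hdq₃⟩ := hcl j₃ hd₃
  rw [hc₁] at hdq₁; rw [hc₂] at hdq₂; rw [hc₃] at hdq₃
  have hdi : ∀ (j : Fin N) (e : Fin s) (i : Fin 2), d j = g j • q e → ((d j i : ℕ) : ℤ) = (g j : ℤ) * (q e i : ℤ) := by
    intro j e i h; rw [h]; simp
  -- the two vectors of the relation
  set z₁ : Fin 2 → ℤ := (k₁ : ℤ) • (σ e₁ • expZ (q e₁)) with hz₁
  set z₂ : Fin 2 → ℤ := (k₂ : ℤ) • (σ e₂ • expZ (q e₂)) with hz₂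
  have hz₁i : ∀ i, z₁ i = (k₁ : ℤ) * σ e₁ * (q e₁ i : ℤ) := by intro i; simp [hz₁]; ring
  have hz₂i : ∀ i, z₂ i = (k₂ : ℤ) * σ e₂ * (q e₂ i : ℤ) := by intro i; simp [hz₂]; ring
  -- multiplicity bound along a line, against the stub's sum over parallel exponents
  have hmult : ∀ (e : Fin s) (jm : Fin N), d jm ≠ 0 → d jm = g jm • q e → ∀ i : Fin 2,
      ((∑ j ∈ Finset.univ.filter (fun j => d j ≠ 0 ∧ cl j = e), g j : ℕ) : ℤ) * (q e i : ℤ) ≤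
        ∑ j, if (d j 0 : ℤ) * (d jm 1 : ℤ) = (d j 1 : ℤ) * (d jm 0 : ℤ) then (d j i : ℤ) else 0 := by
    intro e jm hdm hdqm i
    rw [← Finset.sum_filter]
    push_cast
    rw [Finset.sum_mul]
    have hsub : (Finset.univ.filter fun j => d j ≠ 0 ∧ cl j = e) ⊆
        Finset.univ.filter fun j => (d j 0 : ℤ) * (d jm 1 : ℤ) = (d j 1 : ℤ) * (d jm 0 : ℤ) := by
      intro j hj
      obtain ⟨hdj, hcj⟩ := (Finset.mem_filter.mp hj).2
      have hdqj := (hcl j hdj).2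
      rw [hcj] at hdqj
      refine Finset.mem_filter.mpr ⟨Finset.mem_univ j, ?_⟩
      rw [hdi j e 0 hdqj, hdi j e 1 hdqj, hdi jm e 0 hdqm, hdi jm e 1 hdqm]; ring
    calc ∑ j ∈ Finset.univ.filter (fun j => d j ≠ 0 ∧ cl j = e), (g j : ℤ) * (q e i : ℤ)
        = ∑ j ∈ Finset.univ.filter (fun j => d j ≠ 0 ∧ cl j = e), ((d j i : ℕ) : ℤ) := by
          refine Finset.sum_congr rfl fun j hj => ?_
          obtain ⟨hdj, hcj⟩ := (Finset.mem_filter.mp hj).2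
          have hdqj := (hcl j hdj).2
          rw [hcj] at hdqj
          rw [hdi j e i hdqj]
      _ ≤ _ := Finset.sum_le_sum_of_subset_of_nonneg hsub fun j _ _ => by positivity
  -- apply the hypothesis
  refine H j₁ j₂ j₃ z₁ z₂ hd₁ hd₂ hd₃ ?_ ?_ ?_ ?_ ?_ ?_ ?_ ?_
  · -- the two lines are not parallel
    intro hpar
    apply hqq e₁ e₂ hne
    rw [hdi j₁ e₁ 0 hdq₁, hdi j₁ e₁ 1 hdq₁, hdi j₂ e₂ 0 hdq₂, hdi j₂ e₂ 1 hdq₂] at hpar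
    have hg : ((g j₁ : ℤ) * (g j₂ : ℤ)) ≠ 0 := by
      apply mul_ne_zero <;> exact_mod_cast (by omega : _ ≠ 0)
    have : (g j₁ : ℤ) * (g j₂ : ℤ) * ((q e₁ 0 : ℤ) * (q e₂ 1 : ℤ) - (q e₁ 1 : ℤ) * (q e₂ 0 : ℤ)) = 0 := by
      linear_combination hpar
    rcases mul_eq_zero.mp this with h | h
    · exact absurd h hg
    · exact_mod_cast (sub_eq_zero.mp h)
  · -- `z₁ ≠ 0`
    intro h0
    have hq : q e₁ ≠ 0 := hq0 e₁
    apply hq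
    ext i
    have := congr_fun h0 i
    rw [hz₁i] at this
    simp only [Pi.zero_apply, mul_eq_zero, Nat.cast_eq_zero] at this
    rcases this with (h | h) | h
    · omega
    · exact absurd h (hσne _)
    · simpa using h
  · rw [hz₁i, hz₁i, hdi j₁ e₁ 0 hdq₁, hdi j₁ e₁ 1 hdq₁]; ring
  · intro i
    rw [hz₁i, abs_mul, abs_mul, hσabs, mul_one, Nat.abs_cast, Nat.abs_cast]
    refine le_trans ?_ (hmult e₁ j₁ hd₁ hdq₁ i)
    exact mul_le_mul_of_nonneg_right (by exact_mod_cast hk₁m) (by positivity)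
  · intro h0
    have hq : q e₂ ≠ 0 := hq0 e₂
    apply hq
    ext i
    have := congr_fun h0 i
    rw [hz₂i] at this
    simp only [Pi.zero_apply, mul_eq_zero, Nat.cast_eq_zero] at this
    rcases this with (h | h) | h
    · omega
    · exact absurd h (hσne _)
    · simpa using h
  · rw [hz₂i, hz₂i, hdi j₂ e₂ 0 hdq₂, hdi j₂ e₂ 1 hdq₂]; ring
  · intro i
    rw [hz₂i, abs_mul, abs_mul, hσabs, mul_one, Nat.abs_cast, Nat.abs_cast]
    refine le_trans ?_ (hmult e₂ j₂ hd₂ hdq₂ i)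
    exact mul_le_mul_of_nonneg_right (by exact_mod_cast hk₂m) (by positivity)
  · -- the sum is parallel to `d j₃`
    have hsum0 : z₁ 0 + z₂ 0 = (k : ℤ) * σ e₀ * (q e₀ 0 : ℤ) := by
      have := congr_fun hray' 0; simp [hz₁, hz₂] at this ⊢; linarith
    have hsum1 : z₁ 1 + z₂ 1 = (k : ℤ) * σ e₀ * (q e₀ 1 : ℤ) := by
      have := congr_fun hray' 1; simp [hz₁, hz₂] at this ⊢; linarith
    rw [hsum0, hsum1, hdi j₃ e₀ 0 hdq₃, hdi j₃ e₀ 1 hdq₃]; ring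

end K3Pi

end Summit.ValiantsHypothesis.ValiantsHypothesis.Theorems.NewtonUnitEquationsNewtonTauWeak

end
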